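import Literature.AnabelianGeometry.SemiGraphs.UniformSplittingProofs
import Literature.AnabelianGeometry.SemiGraphs.CoveringGraphGaloisCountable
import HarnessLib

/-!
# The hypotheses of [SemiAnbd] Prop 3.6 / Thm 3.7 / Cor 3.9 are hereditary for connected tempered
# coverings of COHERENT semi-graphs of anabelioids — finite or infinite covering degree (route T, T7d∞)

Mochizuki, *Semi-graphs of anabelioids*, Publ. RIMS **42** (2006), §2 Def. 2.3 (iii) p. 25
(quasi-coherent / coherent), §3 Def. 3.5 (i)–(ii) p. 37 (the covering semi-graph of anabelioids
`G_S → G` of an object `S` of `B^cov(G)`, `CovObj.coveringGraph`; tempered coverings), proof of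
Prop. 3.6 (v) p. 40 ("it follows from the coherence of `G` … that there exists a finite étale covering
`H~ → G` whose pull-back to `G'` splits the restrictions of `H' → G'` to each of the `G'_c`")
[cite: MochizukiSemiAnbd2006, Prop 3.6(v) p.40]; Galois-countability (T2) and the errata (E7) of
[IUTchI] Rmk. 2.5.3 [cite: Mochizuki2012, IUTchI Rem. 2.5.3(i)(T2) p.52].

PROOF-ONLY (abc-iut cell, layer L3, route T · T7d∞, seat abc-iut-L3-t5; no definition, no statement of
the paper retyped).  The tree proves the heredity of the hypotheses of Prop. 3.6 along connected
tempered coverings `S` for STRICTLY coherent bases ([IUTchI] Rmk. 2.5.3 (i) (T3)/(T4);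
`CovObj.prop36Hypotheses_coveringGraph`, abc-iut-L3-d6): the uniform bound on the number of
topological generators gives, at every constituent, a characteristic open subgroup of BOUNDED index
below every open subgroup of index `≤ K`.  Here the base is merely COHERENT (Def. 2.3 (iii): every
`Π_c` topologically finitely generated, no uniform bound — the generality of print's Prop. 3.6 (v)), and
`S` is an arbitrary connected tempered covering, in particular of INFINITE degree, where the naive
argument "the composite `H' → G_S → G` is a finite étale covering of `G`" is unavailable.  The
uniformity is supplied, exactly as in the tree's proof of Prop. 3.6 (v) for coherent `G`
(`CovObj.uniformSplittingAt_of_isCoherent`), by the (T2)-diagonal of `GaloisCountableUniformity`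
(`exists_uniform_fixator_V` / `_E`) off a finite set of constituents and by (T4)
(`exists_open_normal_le_ker`) on the finitely many exceptional ones:

* `exists_uniform_deep_subgroups` — for every `K`, open subgroups `U_c ⊆ Π_c` of index bounded
  UNIFORMLY in `c`, each inside every open subgroup of `Π_c` of index `≤ K`;
* `exists_deep_finite_cover` — ONE finite object of `B^cov(G)` with nonempty fibres all of whose
  point stabilisers lie, at every constituent, in every open subgroup of index `≤ K` (quasi-coherence
  on the cosets of the `U_c` and the trivialising covering of the resulting approximator) — the
  finite replacement of the infinite composite `H' → G_S → G`;
* `CovObj.isQuasiCoherent_coveringGraph_of_isCoherent`, `CovObj.isCoherent_coveringGraph_of_isCoherent`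
  — Def. 2.3 (iii) is hereditary (abc-iut-L3-d6's `isQuasiCoherent_coveringGraph_of_le_fixatorIn`
  fed with the uniform deep subgroups; Schreier for finite generation);
* `CovObj.isGaloisCountable_coveringGraph_of_isCoherent` — **(T2) for `G_S`**: the countable family
  `K ↦ (G_S → G)^*(F_K)` of pulled-back deep finite covers; a finite object `H` of `B^cov(G_S)` has
  constant fibre cardinality `d` on the connected `G_S`, and the member `K := D · d!` splits `H` at every
  point, `D` being the degree of one finite étale covering of `G` splitting `S`;
* assembly `CovObj.prop36Hypotheses_coveringGraph_of_isCoherent` (and `thm37…`, `cor39…`, tower form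
  `…_and_isCoherent_…`): the class {hypotheses of Prop. 3.6 (resp. Thm. 3.7, Cor. 3.9) ∧ coherent} is
  hereditary along connected tempered coverings, finite or infinite.

Honest framing: "coherent" cannot be weakened to "quasi-coherent" here — over a one-vertex base with a
non-finitely-generated vertex group the `ℤ`-unwinding has a non-Galois-countable covering graph
(companion negative file of this seat); print's Prop. 3.6 (v) assumes coherence.  Nothing here bears on
[IUTchIII] Cor. 3.12.
-/

noncomputable section

open CategoryTheory Topology

namespace Literature.AnabelianGeometry.SemiGraphs

open Literature.AnabelianGeometry.AbsoluteAnabelian.IsTopologicallyFinitelyGenerated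
  (exists_open_normal_le_ker)
open Literature.AlgebraicGeometry.Frobenioids (IsConnectedObj)

universe u

namespace ProfiniteSemiGraph

variable {𝒢 : ProfiniteSemiGraph.{u}}

/-! ### 1. Uniformly deep open subgroups of bounded index over a coherent base -/

/-- **Uniform deep subgroups** ([SemiAnbd] proof of Prop. 3.6 (v), p. 40, "it follows from the
coherence of `G`", read with [IUTchI] Rmk. 2.5.3 (i) (T2)/(T4)): for `G` as in Prop. 3.6 and COHERENT and
every `K`, there are a bound `β` and open subgroups `U_v ⊆ Π_v`, `U_e ⊆ Π_e` of nonzero index `≤ β`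
contained in every open subgroup of index `≤ K` of their constituent — off the finite exceptional sets
of `exists_uniform_fixator_V` / `_E` the pointwise stabilisers of one finite étale covering, on them the
(T4) subgroups of the topologically finitely generated constituents.
[cite: MochizukiSemiAnbd2006, Prop 3.6(v) p.40] -/
theorem exists_uniform_deep_subgroups (h36 : 𝒢.Prop36Hypotheses) (hcoh : 𝒢.IsCoherent) (K : ℕ) :
    ∃ β : ℕ,
      (∀ v : 𝒢.graph.Vertex, ∃ U : Subgroup (𝒢.Gv v), IsOpen (U : Set (𝒢.Gv v)) ∧ U.index ≠ 0 ∧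
        U.index ≤ β ∧ ∀ N : Subgroup (𝒢.Gv v), IsOpen (N : Set (𝒢.Gv v)) → N.index ≠ 0 →
          N.index ≤ K → U ≤ N) ∧
      ∀ e : 𝒢.graph.Edge, ∃ U : Subgroup (𝒢.Ge e), IsOpen (U : Set (𝒢.Ge e)) ∧ U.index ≠ 0 ∧
        U.index ≤ β ∧ ∀ N : Subgroup (𝒢.Ge e), IsOpen (N : Set (𝒢.Ge e)) → N.index ≠ 0 →
          N.index ≤ K → U ≤ N := by
  classical
  obtain ⟨-, hgenV, hgenE⟩ := hcoh
  obtain ⟨v₀⟩ := h36.hasVertex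
  -- (T2)-uniformity at level `K`: the finite coverings `F₁`, `F₂` and their finite exceptional sets
  obtain ⟨F₁, h1fin, -, hEV⟩ := exists_uniform_fixator_V h36.isQuasiCoherent h36.isGaloisCountable K
  obtain ⟨F₂, h2fin, -, hEE⟩ := exists_uniform_fixator_E h36.isQuasiCoherent h36.isGaloisCountable K
  haveI : ∀ v, Finite (F₁.SV v).obj.V := h1fin.finite_V
  haveI : ∀ e, Finite (F₂.SE e).obj.V := h2fin.finite_E
  let D₁ : ℕ := F₁.nodeCard (Sum.inl v₀)
  have hD₁ : ∀ n : 𝒢.graph.Node, F₁.nodeCard n = D₁ := fun n =>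
    F₁.nodeCard_eq_of_reachable (h36.isConnected.connected.preconnected n (Sum.inl v₀))
  let D₂ : ℕ := F₂.nodeCard (Sum.inl v₀)
  have hD₂ : ∀ n : 𝒢.graph.Node, F₂.nodeCard n = D₂ := fun n =>
    F₂.nodeCard_eq_of_reachable (h36.isConnected.connected.preconnected n (Sum.inl v₀))
  -- (T4) on the exceptional components: topological generators and their bounds
  choose sV hsV using hgenV
  choose sE hsE using hgenE
  let βV : 𝒢.graph.Vertex → ℕ := fun v => (K.factorial) ^ ((K.factorial) ^ (sV v).card)
  let βE : 𝒢.graph.Edge → ℕ := fun e => (K.factorial) ^ ((K.factorial) ^ (sE e).card)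
  let B : ℕ := max (max D₁.factorial D₂.factorial) (max (hEV.toFinset.sup βV) (hEE.toFinset.sup βE))
  refine ⟨B, fun v => ?_, fun e => ?_⟩
  · by_cases hv : v ∈ {v : 𝒢.graph.Vertex | ∃ N : Subgroup (𝒢.Gv v), IsOpen (N : Set (𝒢.Gv v)) ∧
        N.index ≠ 0 ∧ N.index ≤ K ∧ ¬ CovObj.fixator (F₁.SV v) ≤ N}
    · obtain ⟨U, -, hUo, hUi, hUβ, hUker⟩ := exists_open_normal_le_ker (sV v) (hsV v) K
      refine ⟨U, hUo, hUi, hUβ.trans ?_,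
        fun N hNo hNi hNK => CovObj.le_of_index_le U hUker N hNo hNi hNK⟩
      calc βV v ≤ hEV.toFinset.sup βV := Finset.le_sup (f := βV) (hEV.mem_toFinset.mpr hv)
        _ ≤ B := le_max_of_le_right (le_max_left _ _)
    · refine ⟨CovObj.fixator (F₁.SV v), CovObj.isOpen_fixator _, CovObj.index_fixator_ne_zero _, ?_,
        fun N hNo hNi hNK => ?_⟩
      · have h1v : Nat.card (F₁.SV v).obj.V = D₁ := hD₁ (Sum.inl v)
        calc (CovObj.fixator (F₁.SV v)).index ≤ (Nat.card (F₁.SV v).obj.V).factorial :=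
              CovObj.index_fixator_le _
          _ = D₁.factorial := by rw [h1v]
          _ ≤ B := le_max_of_le_left (le_max_left _ _)
      · by_contra hle
        exact hv ⟨N, hNo, hNi, hNK, hle⟩
  · by_cases he : e ∈ {e : 𝒢.graph.Edge | ∃ N : Subgroup (𝒢.Ge e), IsOpen (N : Set (𝒢.Ge e)) ∧
        N.index ≠ 0 ∧ N.index ≤ K ∧ ¬ CovObj.fixator (F₂.SE e) ≤ N}
    · obtain ⟨U, -, hUo, hUi, hUβ, hUker⟩ := exists_open_normal_le_ker (sE e) (hsE e) K
      refine ⟨U, hUo, hUi, hUβ.trans ?_,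
        fun N hNo hNi hNK => CovObj.le_of_index_le U hUker N hNo hNi hNK⟩
      calc βE e ≤ hEE.toFinset.sup βE := Finset.le_sup (f := βE) (hEE.mem_toFinset.mpr he)
        _ ≤ B := le_max_of_le_right (le_max_right _ _)
    · refine ⟨CovObj.fixator (F₂.SE e), CovObj.isOpen_fixator _, CovObj.index_fixator_ne_zero _, ?_,
        fun N hNo hNi hNK => ?_⟩
      · have h2e : Nat.card (F₂.SE e).obj.V = D₂ := hD₂ (Sum.inr (Sum.inl e))
        calc (CovObj.fixator (F₂.SE e)).index ≤ (Nat.card (F₂.SE e).obj.V).factorial :=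
              CovObj.index_fixator_le _
          _ = D₂.factorial := by rw [h2e]
          _ ≤ B := le_max_of_le_left (le_max_right _ _)
      · by_contra hle
        exact he ⟨N, hNo, hNi, hNK, hle⟩

/-- **One finite étale covering of `G`, deep at index `≤ K` at EVERY constituent** (the finite
replacement of the composite `H' → G_S → G`, which is not a finite object when `S` has infinite
degree): for `G` as in Prop. 3.6 and coherent, and every `K`, a finite object of `B^cov(G)` with
nonempty fibres all of whose point stabilisers lie in every open subgroup of index `≤ K` — quasi-
coherence applied to the cosets of the uniform deep subgroups, then the trivialising covering of the
approximator. [cite: MochizukiSemiAnbd2006, Prop 3.6(v) p.40] -/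
theorem exists_deep_finite_cover (h36 : 𝒢.Prop36Hypotheses) (hcoh : 𝒢.IsCoherent) (K : ℕ) :
    ∃ F : CovObj 𝒢, F.IsFinite ∧ F.HasNonemptyFibres ∧
      (∀ (v : 𝒢.graph.Vertex) (z : (F.SV v).obj.V) (k : 𝒢.Gv v), (F.SV v).obj.ρ k z = z →
        ∀ N : Subgroup (𝒢.Gv v), IsOpen (N : Set (𝒢.Gv v)) → N.index ≠ 0 → N.index ≤ K → k ∈ N) ∧
      ∀ (e : 𝒢.graph.Edge) (z : (F.SE e).obj.V) (k : 𝒢.Ge e), (F.SE e).obj.ρ k z = z →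
        ∀ N : Subgroup (𝒢.Ge e), IsOpen (N : Set (𝒢.Ge e)) → N.index ≠ 0 → N.index ≤ K → k ∈ N := by
  classical
  obtain ⟨B, hV, hE⟩ := exists_uniform_deep_subgroups h36 hcoh K
  choose UV hUVo hUVi hUVB hUVN using hV
  choose UE hUEo hUEi hUEB hUEN using hE
  haveI : ∀ v, (UV v).FiniteIndex := fun v => ⟨hUVi v⟩
  haveI : ∀ e, (UE e).FiniteIndex := fun e => ⟨hUEi e⟩
  obtain ⟨A, hAV, hAE⟩ := h36.isQuasiCoherent B
    (fun v => CovObj.cosetsObj (UV v) (hUVo v) (hUVi v))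
    (fun e => CovObj.cosetsObj (UE e) (hUEo e) (hUEi e))
    (fun v => ⟨hUVB v, inferInstanceAs (Finite (𝒢.Gv v ⧸ UV v))⟩)
    (fun e => ⟨hUEB e, inferInstanceAs (Finite (𝒢.Ge e ⧸ UE e))⟩)
  have hkerV : ∀ v (g : 𝒢.Gv v), A.πV v g = 1 → g ∈ UV v := fun v g hg =>
    CovObj.mem_of_cosetsObj_fixed (UV v) (hUVo v) (hUVi v) g (hAV v g hg)
  have hkerE : ∀ e (g : 𝒢.Ge e), A.πE e g = 1 → g ∈ UE e := fun e g hg =>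
    CovObj.mem_of_cosetsObj_fixed (UE e) (hUEo e) (hUEi e) g (hAE e g hg)
  obtain ⟨M, hM, hdvd⟩ := A.bounded
  refine ⟨A.trivCov hM hdvd, A.trivCov_isFinite hM hdvd, A.trivCov_hasNonemptyFibres hM hdvd,
    fun v z k hz N hNo hNi hNK => ?_, fun e z k hz N hNo hNi hNK => ?_⟩
  · exact hUVN v N hNo hNi hNK (hkerV v k (CovObj.πV_eq_one_of_trivCov_ρ_eq A hM hdvd v z k hz))
  · exact hUEN e N hNo hNi hNK (hkerE e k (CovObj.πE_eq_one_of_trivCov_ρ_eq A hM hdvd e z k hz))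

namespace CovObj

variable (S : CovObj 𝒢)

/-! ### 2. Quasi-coherence and coherence of `G_S` over a coherent base -/

/-- **Quasi-coherence ([SemiAnbd] Def. 2.3 (iii)) is hereditary for connected tempered coverings of a
COHERENT `G`** as in Prop. 3.6 (finite or infinite degree): the constituents `Stab_{Π_c}(s_ω)` of `G_S`
have nonzero indices `≤ D`, a family of their coverings of degree `≤ M` is fixed pointwise by every open
subgroup of `Π_c` of index `≤ D · M!` (`index_fixatorIn_le`), and the uniform deep subgroups at
`K := D · M!` feed abc-iut-L3-d6's `isQuasiCoherent_coveringGraph_of_le_fixatorIn`.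
[cite: MochizukiSemiAnbd2006, Def 2.3(iii) p.25] -/
theorem isQuasiCoherent_coveringGraph_of_isCoherent (h36 : 𝒢.Prop36Hypotheses)
    (hcoh : 𝒢.IsCoherent) (hS : S.IsTempered) (hSc : IsConnectedObj (⟨S, hS⟩ : BTempCat 𝒢)) :
    S.coveringGraph.IsQuasiCoherent := by
  classical
  obtain ⟨D, hDV, hDE⟩ := S.exists_index_stab_le h36.isConnected hS hSc
  refine S.isQuasiCoherent_coveringGraph_of_le_fixatorIn h36.isQuasiCoherent
    fun M HV HE hHV hHE => ?_
  obtain ⟨β, hV, hE⟩ := exists_uniform_deep_subgroups h36 hcoh (D * M.factorial)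
  choose UV hUVo hUVi hUVB hUVN using hV
  choose UE hUEo hUEi hUEB hUEN using hE
  refine ⟨β, UV, UE, fun v => ⟨hUVo v, hUVi v, hUVB v⟩, fun e => ⟨hUEo e, hUEi e, hUEB e⟩,
    fun v' => ?_, fun e' => ?_⟩
  · haveI : Finite (HV v').obj.V := (hHV v').2
    obtain ⟨h0, hle⟩ := index_fixatorIn_le (BTemp.stab (S.SV v'.1) (Quot.out v'.2))
      (hDV v'.1 _).1 (hDV v'.1 _).2 (HV v') (hHV v').1
    exact hUVN v'.1 _ (isOpen_fixatorIn _ ((S.SV v'.1).property.2 _) _) h0 hle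
  · haveI : Finite (HE e').obj.V := (hHE e').2
    obtain ⟨h0, hle⟩ := index_fixatorIn_le (BTemp.stab (S.SE e'.1) (Quot.out e'.2))
      (hDE e'.1 _).1 (hDE e'.1 _).2 (HE e') (hHE e').1
    exact hUEN e'.1 _ (isOpen_fixatorIn _ ((S.SE e'.1).property.2 _) _) h0 hle

/-- **Coherence ([SemiAnbd] Def. 2.3 (iii)) is hereditary for connected tempered coverings of a coherent
`G`** as in Prop. 3.6: quasi-coherence by the previous theorem, and every constituent
`Stab_{Π_c}(s_ω)` of `G_S` is an open subgroup of finite index of a topologically finitely generated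
compact group, hence topologically finitely generated (Schreier,
`Subgroup.exists_finset_card_le_mul_of_dense`). [cite: MochizukiSemiAnbd2006, Def 2.3(iii) p.25] -/
theorem isCoherent_coveringGraph_of_isCoherent (h36 : 𝒢.Prop36Hypotheses) (hcoh : 𝒢.IsCoherent)
    (hS : S.IsTempered) (hSc : IsConnectedObj (⟨S, hS⟩ : BTempCat 𝒢)) :
    S.coveringGraph.IsCoherent := by
  classical
  refine ⟨S.isQuasiCoherent_coveringGraph_of_isCoherent h36 hcoh hS hSc, ?_, ?_⟩
  · rintro ⟨v, ω⟩
    obtain ⟨s, hgen⟩ := hcoh.2.1 v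
    obtain ⟨t, -, ht⟩ := Subgroup.exists_finset_card_le_mul_of_dense s hgen
      (BTemp.stab (S.SV v) (Quot.out ω)) ((S.SV v).property.2 _)
    exact ⟨t, ht⟩
  · rintro ⟨e, ω⟩
    obtain ⟨s, hgen⟩ := hcoh.2.2 e
    obtain ⟨t, -, ht⟩ := Subgroup.exists_finset_card_le_mul_of_dense s hgen
      (BTemp.stab (S.SE e) (Quot.out ω)) ((S.SE e).property.2 _)
    exact ⟨t, ht⟩

/-! ### 3. (T2) Galois-countability of `G_S` over a coherent base -/

/-- **`G_S` is Galois-countable ([IUTchI] Rmk. 2.5.3 (i) (T2)) for `G` as in Prop. 3.6 and COHERENT and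
`S` a connected tempered covering of finite or INFINITE degree.**  The (T2)-family of `G_S` is
`K ↦ (G_S → G)^*(F_K)` with `F_K` the deep finite cover of `exists_deep_finite_cover`; a finite object
`H` of `B^cov(G_S)` has constant fibre cardinality `d` on the connected `G_S`, the subgroup of
`Stab_{Π_c}(s_ω)` fixing `H_{(c,ω)}` pointwise is open of index `≤ D · d!` in `Π_c` (`D` the degree of
one finite étale covering of `G` splitting `S`), so the member `K := D · d!` splits `H` at every point.
[cite: Mochizuki2012, IUTchI Rem. 2.5.3(i)(T2) p.52] -/
theorem isGaloisCountable_coveringGraph_of_isCoherent (h36 : 𝒢.Prop36Hypotheses)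
    (hcoh : 𝒢.IsCoherent) (hS : S.IsTempered) (hSc : IsConnectedObj (⟨S, hS⟩ : BTempCat 𝒢)) :
    S.coveringGraph.IsGaloisCountable := by
  classical
  choose F hFfin hFne hFV hFE using fun K : ℕ => exists_deep_finite_cover h36 hcoh K
  refine ⟨S.isCountable_coveringGraph h36.isCountable, fun K => S.coveringHom.covPullback.obj (F K),
    fun K => ⟨S.coveringHom.isFinite_covPullback (hFfin K),
      S.coveringHom.hasNonemptyFibres_covPullback (hFne K)⟩, fun H hH => ?_⟩
  haveI : ∀ v', Finite (H.SV v').obj.V := hH.finite_V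
  haveI : ∀ e', Finite (H.SE e').obj.V := hH.finite_E
  obtain ⟨D, hDV, hDE⟩ := S.exists_index_stab_le h36.isConnected hS hSc
  have hconn : S.coveringGraph.IsConnected := S.isConnected_coveringGraph hS hSc
  obtain ⟨n₀⟩ := hconn.connected.nonempty
  let d : ℕ := H.nodeCard n₀
  have hd : ∀ n : S.coveringGraph.graph.Node, H.nodeCard n = d := fun n =>
    H.nodeCard_eq_of_reachable (hconn.connected.preconnected n n₀)
  refine ⟨D * d.factorial, fun v' z k hz y => ?_, fun e' z k hz y => ?_⟩
  · let L : Subgroup (𝒢.Gv v'.1) := BTemp.stab (S.SV v'.1) (Quot.out v'.2)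
    have hHv : Nat.card (H.SV v').obj.V ≤ d := (hd (Sum.inl v')).le
    obtain ⟨h0, hle⟩ := index_fixatorIn_le L (hDV v'.1 _).1 (hDV v'.1 _).2 (H.SV v') hHv
    have hk : (k : 𝒢.Gv v'.1) ∈ fixatorIn L (H.SV v') :=
      hFV (D * d.factorial) v'.1 z k hz _ (isOpen_fixatorIn L ((S.SV v'.1).property.2 _) _) h0 hle
    exact (mem_fixator_iff _ _).mp ((mem_fixatorIn_iff L _ k).mp hk) y
  · let L : Subgroup (𝒢.Ge e'.1) := BTemp.stab (S.SE e'.1) (Quot.out e'.2)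
    have hHe : Nat.card (H.SE e').obj.V ≤ d := (hd (Sum.inr (Sum.inl e'))).le
    obtain ⟨h0, hle⟩ := index_fixatorIn_le L (hDE e'.1 _).1 (hDE e'.1 _).2 (H.SE e') hHe
    have hk : (k : 𝒢.Ge e'.1) ∈ fixatorIn L (H.SE e') :=
      hFE (D * d.factorial) e'.1 z k hz _ (isOpen_fixatorIn L ((S.SE e'.1).property.2 _) _) h0 hle
    exact (mem_fixator_iff _ _).mp ((mem_fixatorIn_iff L _ k).mp hk) y

/-! ### 4. Assembly: {hypotheses of Prop 3.6 / Thm 3.7 / Cor 3.9 ∧ coherent} is hereditary -/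

/-- **The hypotheses of [SemiAnbd] Prop. 3.6 are hereditary over COHERENT bases**: for `G` satisfying
them and coherent and `S` a connected tempered covering (any degree), `G_S` satisfies them
(connected/countable/injective type/slim: T7a; aloof: T7b; elevated: T7c; quasi-coherent,
Galois-countable: this file). [cite: MochizukiSemiAnbd2006, Prop 3.6 p.38] -/
theorem prop36Hypotheses_coveringGraph_of_isCoherent (h36 : 𝒢.Prop36Hypotheses)
    (hcoh : 𝒢.IsCoherent) (hS : S.IsTempered) (hSc : IsConnectedObj (⟨S, hS⟩ : BTempCat 𝒢)) :
    S.coveringGraph.Prop36Hypotheses where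
  isConnected := S.isConnected_coveringGraph hS hSc
  isCountable := S.isCountable_coveringGraph h36.isCountable
  isGaloisCountable := S.isGaloisCountable_coveringGraph_of_isCoherent h36 hcoh hS hSc
  hasVertex := S.hasVertex_coveringGraph_of_isConnectedObj h36.isConnected h36.hasVertex hS hSc
  isOfInjectiveType := S.isOfInjectiveType_coveringGraph h36.isOfInjectiveType
  isQuasiCoherent := S.isQuasiCoherent_coveringGraph_of_isCoherent h36 hcoh hS hSc
  isTotallyElevated := S.isTotallyElevated_coveringGraph h36.isTotallyElevated hS
  isTotallyAloof := S.isTotallyAloof_coveringGraph h36.isTotallyAloof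
  isVerticiallySlim := S.isVerticiallySlim_coveringGraph h36.isVerticiallySlim

/-- **The hypotheses of [SemiAnbd] Thm. 3.7 are hereditary over coherent bases** (same setting, `G`
totally estranged). [cite: MochizukiSemiAnbd2006, Thm 3.7 p.40] -/
theorem thm37Hypotheses_coveringGraph_of_isCoherent (h37 : 𝒢.Thm37Hypotheses)
    (hcoh : 𝒢.IsCoherent) (hS : S.IsTempered) (hSc : IsConnectedObj (⟨S, hS⟩ : BTempCat 𝒢)) :
    S.coveringGraph.Thm37Hypotheses where
  toProp36Hypotheses := S.prop36Hypotheses_coveringGraph_of_isCoherent h37.toProp36Hypotheses hcoh hS hSc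
  isTotallyEstranged := S.isTotallyEstranged_coveringGraph h37.isTotallyEstranged

/-- **The hypotheses of [SemiAnbd] Cor. 3.9 are hereditary over coherent bases** (same setting, `G` a
graph). [cite: MochizukiSemiAnbd2006, Cor 3.9 p.42] -/
theorem cor39Hypotheses_coveringGraph_of_isCoherent (h39 : Cor39Hypotheses 𝒢)
    (hcoh : 𝒢.IsCoherent) (hS : S.IsTempered) (hSc : IsConnectedObj (⟨S, hS⟩ : BTempCat 𝒢)) :
    Cor39Hypotheses S.coveringGraph where
  toProp36Hypotheses := S.prop36Hypotheses_coveringGraph_of_isCoherent h39.toProp36Hypotheses hcoh hS hSc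
  isTotallyEstranged := S.isTotallyEstranged_coveringGraph h39.isTotallyEstranged
  isGraph := S.isGraph_coveringGraph h39.isGraph

/-- **Heredity along towers, coherent form**: the class "hypotheses of Prop. 3.6 + coherent" passes from
`G` to `G_S` for every connected tempered `S`, so it iterates along towers of connected tempered
coverings of arbitrary degree (`Ÿ → Y → X`). [cite: MochizukiSemiAnbd2006, Prop 3.6(v) p.40] -/
theorem prop36Hypotheses_and_isCoherent_coveringGraph (h36 : 𝒢.Prop36Hypotheses)
    (hcoh : 𝒢.IsCoherent) (hS : S.IsTempered) (hSc : IsConnectedObj (⟨S, hS⟩ : BTempCat 𝒢)) :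
    S.coveringGraph.Prop36Hypotheses ∧ S.coveringGraph.IsCoherent :=
  ⟨S.prop36Hypotheses_coveringGraph_of_isCoherent h36 hcoh hS hSc,
    S.isCoherent_coveringGraph_of_isCoherent h36 hcoh hS hSc⟩

/-- **Heredity along towers, Thm. 3.7 form**: "hypotheses of Thm. 3.7 + coherent" is hereditary along
connected tempered coverings of arbitrary degree. [cite: MochizukiSemiAnbd2006, Thm 3.7 p.40] -/
theorem thm37Hypotheses_and_isCoherent_coveringGraph (h37 : 𝒢.Thm37Hypotheses)
    (hcoh : 𝒢.IsCoherent) (hS : S.IsTempered) (hSc : IsConnectedObj (⟨S, hS⟩ : BTempCat 𝒢)) :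
    S.coveringGraph.Thm37Hypotheses ∧ S.coveringGraph.IsCoherent :=
  ⟨S.thm37Hypotheses_coveringGraph_of_isCoherent h37 hcoh hS hSc,
    S.isCoherent_coveringGraph_of_isCoherent h37.toProp36Hypotheses hcoh hS hSc⟩

end CovObj

end ProfiniteSemiGraph

end Literature.AnabelianGeometry.SemiGraphs
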